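import Literature.NumberTheory.LFunctions.NicolasMellin
import Literature.NumberTheory.LFunctions.MertensTail
import HarnessLib

/-!
# Mertens' theorems with their constants: `∑_{p ≤ x} 1/p = log log x + B₁ + o(1)` and
# `∏_{p ≤ x} (1 - 1/p) ~ e^{-γ}/log x`

Trunk T-ANT (`NumberTheory/LFunctions`). F. Mertens (1874); G. H. Hardy, E. M. Wright, *An
Introduction to the Theory of Numbers*, 6th ed., Thms 427–429 (§§22.7–22.8). Everything in this
file is PROVED (no named facts):

* `tendsto_mertensLog_sub_loglog` : `A(x) - log log x → γ`, where
  `A(x) = ∑_{p ≤ x} -log(1 - 1/p)` (`Literature.NumberTheory.LFunctions.Nicolas.mertensLog`) — the logarithmic form of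
* `tendsto_log_mul_prod_one_sub_inv` : **Mertens' theorem** (HW Thm 429)
  `log x · ∏_{p ≤ x} (1 - 1/p) → e^{-γ}`; reciprocal form `tendsto_prod_one_sub_inv_inv_div_log`
  (`(∏_{p ≤ x} (1 - 1/p))⁻¹ / log x → e^γ`) and integer-indexed form
  `tendsto_log_mul_prod_one_sub_inv_nat`;
* `tendsto_primeRecipSum_sub_loglog` : **Mertens' second theorem with its constant** (HW Thms
  427–428) `∑_{p ≤ x} 1/p - log log x → B₁`, `B₁ = γ + ∑_p (log(1 - 1/p) + 1/p)`
  (`meisselMertens`, HW (22.8.1)), and HW's integral formula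
  `B₁ = 1 - log log 2 + ∫_2^∞ τ(t) dt/(t log² t)` (`meisselMertens_eq_integral`, (22.7.3)).

Motivation (provefact `Literature.NumberTheory.LFunctions.robin_iff`): the normalisation `f(x) = e^γ log θ(x) ∏_{p ≤ x}(1 - 1/p)
→ 1` behind Nicolas's and Robin's inequalities (`NicolasMertensRH.lean`: the named facts
`Nicolas2012_logf_lower`, `Nicolas1983_logf_omega` are statements about `log f`) is Mertens' theorem
with the constant `e^{-γ}` identified; the tree so far had only the crude two-sided bounds of
`MertensElementary.lean` / `MertensTail.lean` (constants `e^{-5}`, `4`, `6/log P`), and Mathlib has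
no Mertens-type asymptotics.

**Proof** (Hardy–Wright §§22.7–22.8, with the Dirichlet series of `A` in place of `∑_p p^{-1-δ}`).
(1) *Existence of the limit* (Thm 427): by partial summation (Mathlib's Abel summation
`sum_mul_eq_sub_sub_integral_mul` with `c_p = log p/p`, `f = 1/log`),
`∑_{p ≤ x} 1/p = S(x)/log x + ∫_2^x S(t) dt/(t log² t)` with `S(t) = ∑_{p ≤ t} log p/p = log t + τ(t)`,
`|τ| ≤ 4` (the tree's explicit Mertens I, `Literature.NumberTheory.LFunctions.MertensBound.sum_log_div_prime_bounds`), whence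
`∑_{p ≤ x} 1/p - log log x = 1 + τ(x)/log x - log log 2 + ∫_2^x τ(t) dt/(t log² t) → B₁`
(`tendsto_primeRecipSum_sub_loglog_integral`); and `A(x) - ∑_{p ≤ x} 1/p → ∑_p (a_p - 1/p)`
(absolutely convergent). (2) *Abelian step* (`tendsto_mul_integral_rpow_of_tendsto`): `h(x) → L`
implies `σ ∫_1^∞ h(x) x^{-σ-1} dx → L` as `σ → 0+`. (3) *Identification* (Thm 428): for real
`σ > 0`, `σ ∫_1^∞ A(x) x^{-σ-1} dx = ∑_p a_p p^{-σ} = primeLogDiff(σ) + log ζ(1+σ)` (the tree's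
`PrimeLogSeries.lean`: `primeLogLSeries_eq_mul_integral`, `primeLogDiff_eq`, `exp_primeZetaLog`) and
`σ ∫_1^∞ log log x · x^{-σ-1} dx = -γ - log σ` (`NicolasMellin.lean`, `integral_loglog_rpow`, from
`Γ'(1) = -γ`), so `σ ∫_1^∞ (A - log log) x^{-σ-1} dx = γ + Re primeLogDiff(σ) + log Re(σ ζ(1+σ)) → γ`
(`primeLogDiff` is holomorphic at `0` with value `0`; `(s-1)ζ(s) → 1`, Mathlib
`riemannZeta_residue_one`). By (1), (2) and uniqueness of limits the limit in (1) for `A` is `γ`.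

## References

* F. Mertens, *Ein Beitrag zur analytischen Zahlentheorie*, J. reine angew. Math. 78 (1874), 46–62.
* G. H. Hardy, E. M. Wright, *An Introduction to the Theory of Numbers*, 6th ed., OUP 2008, §22.7
  (eqs. (22.7.1)–(22.7.4), Thm 427) and §22.8 (Thm 428, eq. (22.8.1); Thm 429, Mertens's theorem);
  book pp. 466–468 (PDF pp. 271–273 of the held copy). [HardyWright2008]
* H. L. Montgomery, R. C. Vaughan, *Multiplicative Number Theory I*, CUP 2007, §1.2 Thm. 1.3
  (partial summation for Dirichlet series), §2.2 Thm. 2.7 (d)–(e). [MontgomeryVaughan2007]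

## Mathlib / tree

Used from Mathlib: `sum_mul_eq_sub_sub_integral_mul` (Abel summation), `riemannZeta_residue_one`,
`intervalIntegral_tendsto_integral_Ioi`, `integrableOn_Ioi_deriv_of_nonneg`, `integral_Ioi_rpow_of_lt`,
`Nat.primesLE`. From the tree: `Literature.NumberTheory.LFunctions.MertensBound.sum_log_div_prime_bounds` (`MertensTail.lean`);
`Literature.NumberTheory.LFunctions.Nicolas.mertensLog`, `primeLogLSeries_eq_mul_integral`, `primeLogDiff_eq`,
`differentiableOn_primeLogDiff`, `primeLogDiff_zero`, `exp_primeZetaLog`, `primeZetaLog_ofReal_im`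
(`PrimeLogSeries.lean`); `Literature.NumberTheory.LFunctions.Nicolas.integral_loglog_rpow`, `integrableOn_loglog_rpow`,
`integrableOn_rpow_of_le_log` (`NicolasMellin.lean`); `Literature.NumberTheory.LFunctions.Landau.mellinIoiLog_ofReal`
(`LandauOscillation.lean`). Mathlib has no Mertens theorems (searched `Mertens`, `primesLE` + `log`,
`eulerMascheroniConstant` in `NumberTheory`).
-/
noncomputable section

open Filter Topology Set MeasureTheory Finset Real

namespace Literature.NumberTheory.LFunctions.Mertens

/-! ### An Abelian lemma: `h(x) → L` implies `σ ∫_1^∞ h(x) x^{-σ-1} dx → L` (`σ → 0+`) -/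

/-- **Abelian lemma for the transform `σ ∫_1^∞ h(x) x^{-σ-1} dx`**: if `h(x) → L` as `x → ∞`
(and the integrals converge absolutely for `σ > 0`), then `σ ∫_1^∞ h(x) x^{-σ-1} dx → L` as
`σ → 0+` (the weight `σ x^{-σ-1} dx` is a probability measure on `(1, ∞)` escaping to infinity).
This is the step "letting `x → ∞` … `δ ∫ t^{-1-δ} E(t) dt → 0`" of Hardy–Wright's proof of
Thm. 428. [cite: HardyWright2008, §22.8, proof of Thm 428] -/
theorem tendsto_mul_integral_rpow_of_tendsto {h : ℝ → ℝ}
    (hint : ∀ σ : ℝ, 0 < σ → IntegrableOn (fun x ↦ h x * x ^ (-(σ + 1))) (Ioi 1))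
    {L : ℝ} (hL : Tendsto h atTop (𝓝 L)) :
    Tendsto (fun σ : ℝ ↦ σ * ∫ x in Ioi (1 : ℝ), h x * x ^ (-(σ + 1))) (𝓝[>] 0) (𝓝 L) := by
  rw [Metric.tendsto_nhds]
  intro ε hε
  have hε3 : 0 < ε / 3 := by positivity
  -- (1) choose `T ≥ 2` with `|h x - L| ≤ ε/3` for `x ≥ T`
  obtain ⟨T₀, hT₀⟩ := Filter.eventually_atTop.1 (hL.eventually (Metric.closedBall_mem_nhds L hε3))
  set T : ℝ := max T₀ 2 with hTdef
  have hT2 : (2 : ℝ) ≤ T := le_max_right _ _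
  have hT1 : (1 : ℝ) ≤ T := by linarith
  have hT0 : (0 : ℝ) < T := by linarith
  have hclose : ∀ x, T ≤ x → |h x - L| ≤ ε / 3 := fun x hx ↦ by
    have := hT₀ x ((le_max_left _ _).trans hx)
    rwa [Real.dist_eq] at this
  -- (2) the constant `M` bounding the contribution of `(1, T]`
  set M : ℝ := ∫ x in Ioc (1 : ℝ) T, T * |h x * x ^ (-((1 : ℝ) + 1))| with hMdef
  have hM0 : 0 ≤ M := setIntegral_nonneg measurableSet_Ioc fun x _ ↦ by positivity
  -- (3) `L T^{-σ} → L`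
  have hTpow : Tendsto (fun σ : ℝ ↦ L * T ^ (-σ) - L) (𝓝 0) (𝓝 0) := by
    have h1 : Tendsto (fun σ : ℝ ↦ T ^ (-σ)) (𝓝 0) (𝓝 1) := by
      have hc : ContinuousAt (fun y : ℝ ↦ T ^ y) (-0) := Real.continuousAt_const_rpow hT0.ne'
      have := hc.tendsto.comp (continuous_neg.tendsto (0 : ℝ))
      simpa [Function.comp_def, neg_zero, Real.rpow_zero] using this
    have h2 := (h1.const_mul L).sub_const L
    rwa [mul_one, sub_self] at h2
  have hev1 : ∀ᶠ σ : ℝ in 𝓝[>] 0, |L * T ^ (-σ) - L| < ε / 3 := by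
    have := Metric.tendsto_nhds.1 (tendsto_nhdsWithin_of_tendsto_nhds (s := Ioi 0) hTpow)
      (ε / 3) hε3
    filter_upwards [this] with σ hσ
    rwa [Real.dist_eq, sub_zero] at hσ
  have hev2 : ∀ᶠ σ : ℝ in 𝓝[>] 0, 0 < σ := self_mem_nhdsWithin
  have hev3 : ∀ᶠ σ : ℝ in 𝓝[>] 0, σ < min 1 (ε / 3 / (M + 1)) := by
    have hpos : (0 : ℝ) < min 1 (ε / 3 / (M + 1)) := lt_min one_pos (by positivity)
    exact mem_nhdsWithin_of_mem_nhds (Iio_mem_nhds hpos)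
  filter_upwards [hev1, hev2, hev3] with σ h1 h2 h3
  have hσ1 : σ < 1 := h3.trans_le (min_le_left _ _)
  have hσM : σ * M < ε / 3 := by
    have h3' : σ < ε / 3 / (M + 1) := h3.trans_le (min_le_right _ _)
    have hM1 : 0 < M + 1 := by linarith
    calc σ * M ≤ σ * (M + 1) := by nlinarith
      _ < ε / 3 / (M + 1) * (M + 1) := by gcongr
      _ = ε / 3 := by field_simp
  -- integrability at this `σ`
  have hI : IntegrableOn (fun x ↦ h x * x ^ (-(σ + 1))) (Ioi 1) := hint σ h2
  have hIT : IntegrableOn (fun x ↦ h x * x ^ (-(σ + 1))) (Ioi T) :=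
    hI.mono_set (Ioi_subset_Ioi hT1)
  have hI1T : IntegrableOn (fun x ↦ h x * x ^ (-(σ + 1))) (Ioc 1 T) :=
    hI.mono_set Ioc_subset_Ioi_self
  have hpowT : IntegrableOn (fun x : ℝ ↦ x ^ (-(σ + 1))) (Ioi T) :=
    integrableOn_Ioi_rpow_of_lt (by linarith) hT0
  have hpow_int : ∫ x in Ioi T, x ^ (-(σ + 1)) = T ^ (-σ) / σ := by
    rw [integral_Ioi_rpow_of_lt (by linarith) hT0, show -(σ + 1) + 1 = -σ by ring, neg_div,
      div_neg, neg_neg]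
  have hdiff : IntegrableOn (fun x ↦ (h x - L) * x ^ (-(σ + 1))) (Ioi T) :=
    (hIT.sub (hpowT.const_mul L)).congr (Eventually.of_forall fun x ↦ by
      simp only [Pi.sub_apply]; ring)
  -- split the integral: `σ ∫_1^∞ h x^{-σ-1} = σ I₁ + σ I₂ + L T^{-σ}`
  have hsplit : ∫ x in Ioi (1 : ℝ), h x * x ^ (-(σ + 1)) =
      (∫ x in Ioc (1 : ℝ) T, h x * x ^ (-(σ + 1))) + ∫ x in Ioi T, h x * x ^ (-(σ + 1)) := by
    rw [← setIntegral_union Ioc_disjoint_Ioi_same measurableSet_Ioi hI1T hIT,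
      Ioc_union_Ioi_eq_Ioi hT1]
  have hsplit2 : ∫ x in Ioi T, h x * x ^ (-(σ + 1)) =
      (∫ x in Ioi T, (h x - L) * x ^ (-(σ + 1))) + L * (T ^ (-σ) / σ) := by
    rw [← hpow_int, ← integral_const_mul, ← integral_add hdiff (hpowT.const_mul L)]
    refine setIntegral_congr_fun measurableSet_Ioi fun x _ ↦ ?_
    ring
  have hkey : σ * (∫ x in Ioi (1 : ℝ), h x * x ^ (-(σ + 1))) - L =
      σ * (∫ x in Ioc (1 : ℝ) T, h x * x ^ (-(σ + 1))) +
        σ * (∫ x in Ioi T, (h x - L) * x ^ (-(σ + 1))) + (L * T ^ (-σ) - L) := by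
    rw [hsplit, hsplit2]
    field_simp
    ring
  -- bound the three pieces
  have hb1 : |∫ x in Ioc (1 : ℝ) T, h x * x ^ (-(σ + 1))| ≤ M := by
    refine (abs_integral_le_integral_abs).trans ?_
    refine setIntegral_mono_on hI1T.abs ?_ measurableSet_Ioc fun x hx ↦ ?_
    · exact (((hint 1 one_pos).mono_set Ioc_subset_Ioi_self).abs.const_mul T)
    · have hx1 : 1 < x := hx.1
      have hx0 : 0 < x := by linarith
      have hpow1 : x ^ (-(σ + 1)) ≤ T * x ^ (-((1 : ℝ) + 1)) := by
        have e1 : x ^ (-(σ + 1)) ≤ x ^ (-(1 : ℝ)) :=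
          Real.rpow_le_rpow_of_exponent_le hx1.le (by linarith)
        have e2 : x ^ (-(1 : ℝ)) = x * x ^ (-((1 : ℝ) + 1)) := by
          rw [← Real.rpow_one_add' hx0.le (by norm_num)]
          norm_num
        have e3 : x * x ^ (-((1 : ℝ) + 1)) ≤ T * x ^ (-((1 : ℝ) + 1)) :=
          mul_le_mul_of_nonneg_right hx.2 (by positivity)
        linarith
      rw [abs_mul, abs_mul, abs_of_pos (Real.rpow_pos_of_pos hx0 _),
        abs_of_pos (Real.rpow_pos_of_pos hx0 _), ← mul_assoc, mul_comm T |h x|, mul_assoc]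
      exact mul_le_mul_of_nonneg_left hpow1 (abs_nonneg _)
  have hb2 : |∫ x in Ioi T, (h x - L) * x ^ (-(σ + 1))| ≤ ε / 3 * (T ^ (-σ) / σ) := by
    refine (abs_integral_le_integral_abs).trans ?_
    rw [← hpow_int, ← integral_const_mul]
    refine setIntegral_mono_on hdiff.abs (hpowT.const_mul _) measurableSet_Ioi fun x hx ↦ ?_
    have hx0 : 0 < x := hT0.trans hx
    rw [abs_mul, abs_of_pos (Real.rpow_pos_of_pos hx0 _)]
    exact mul_le_mul_of_nonneg_right (hclose x hx.le) (by positivity)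
  have hTσ : T ^ (-σ) ≤ 1 := Real.rpow_le_one_of_one_le_of_nonpos hT1 (by linarith)
  have hTσ0 : 0 < T ^ (-σ) := Real.rpow_pos_of_pos hT0 _
  rw [Real.dist_eq, hkey]
  calc |σ * (∫ x in Ioc (1 : ℝ) T, h x * x ^ (-(σ + 1))) +
          σ * (∫ x in Ioi T, (h x - L) * x ^ (-(σ + 1))) + (L * T ^ (-σ) - L)|
      ≤ |σ * (∫ x in Ioc (1 : ℝ) T, h x * x ^ (-(σ + 1)))| +
          |σ * (∫ x in Ioi T, (h x - L) * x ^ (-(σ + 1)))| + |L * T ^ (-σ) - L| :=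
        abs_add_three _ _ _
    _ ≤ σ * M + σ * (ε / 3 * (T ^ (-σ) / σ)) + |L * T ^ (-σ) - L| := by
        rw [abs_mul, abs_mul, abs_of_pos h2]
        gcongr
    _ = σ * M + ε / 3 * T ^ (-σ) + |L * T ^ (-σ) - L| := by field_simp
    _ ≤ σ * M + ε / 3 * 1 + |L * T ^ (-σ) - L| := by gcongr
    _ < ε / 3 + ε / 3 * 1 + ε / 3 := by linarith
    _ = ε := by ring


/-! ### Mertens' second theorem: `∑_{p ≤ x} 1/p - log log x` converges (Hardy–Wright Thm 427) -/

/-- `S(x) = ∑_{p ≤ x} log p / p` (Hardy–Wright's `C(x)` in (22.7.3)).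
[cite: HardyWright2008, §22.7 eq. (22.7.3)] -/
def primeLogDivSum (x : ℝ) : ℝ := ∑ p ∈ Nat.primesLE ⌊x⌋₊, Real.log p / p

/-- `τ(x) = ∑_{p ≤ x} log p / p - log x`, Hardy–Wright's `τ(x) = O(1)` in (22.7.3) (bounded by
Mertens' first theorem, Thm 425). [cite: HardyWright2008, §22.7 eq. (22.7.3)] -/
def mertensTau (x : ℝ) : ℝ := primeLogDivSum x - Real.log x

/-- `P(x) = ∑_{p ≤ x} 1/p`. [cite: HardyWright2008, Thm 427] -/
def primeRecipSum (x : ℝ) : ℝ := ∑ p ∈ Nat.primesLE ⌊x⌋₊, (p : ℝ)⁻¹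

/-- `|τ(x)| ≤ 4` for `x ≥ 1` (the tree's explicit two-sided Mertens I,
`Literature.NumberTheory.LFunctions.MertensBound.sum_log_div_prime_bounds`). [cite: HardyWright2008, Thm 425] -/
theorem abs_mertensTau_le {x : ℝ} (hx : 1 ≤ x) : |mertensTau x| ≤ 4 := by
  have h := Literature.NumberTheory.LFunctions.MertensBound.sum_log_div_prime_bounds hx
  rw [mertensTau, primeLogDivSum, abs_le]
  constructor <;> linarith [h.1, h.2]

/-- Auxiliary (proof-internal). [folklore] -/
theorem measurable_primeLogDivSum : Measurable primeLogDivSum := by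
  have : primeLogDivSum = (fun n : ℕ ↦ ∑ p ∈ Nat.primesLE n, Real.log p / p) ∘ Nat.floor := by
    funext x; simp [primeLogDivSum]
  rw [this]
  exact (measurable_from_nat (f := fun n : ℕ ↦ ∑ p ∈ Nat.primesLE n, Real.log p / p)).comp
    Nat.measurable_floor

/-- Auxiliary (proof-internal). [folklore] -/
theorem measurable_mertensTau : Measurable mertensTau :=
  measurable_primeLogDivSum.sub Real.measurable_log

/-- Auxiliary (proof-internal): `primesLE 2 = {2}`. [folklore] -/
theorem primesLE_two : Nat.primesLE 2 = {2} := by decide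

/-- **Partial summation** (Hardy–Wright (22.7.3), from their Thm 421 = Mathlib's
`sum_mul_eq_sub_sub_integral_mul` with `c_p = log p / p`, `f(t) = 1/log t`): for `x ≥ 2`,
`∑_{p ≤ x} 1/p = S(x)/log x + ∫_2^x S(t)/(t log² t) dt`. [cite: HardyWright2008, §22.7 eq. (22.7.3)] -/
theorem primeRecipSum_eq_add_integral {x : ℝ} (hx : 2 ≤ x) :
    primeRecipSum x = primeLogDivSum x / Real.log x +
      ∫ t in Ioc 2 x, primeLogDivSum t * (t⁻¹ / Real.log t ^ 2) := by
  set c : ℕ → ℝ := fun k => if k.Prime then Real.log k / k else 0 with hc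
  set f : ℝ → ℝ := fun t => (Real.log t)⁻¹ with hf
  set g : ℝ → ℝ := fun t => -t⁻¹ / Real.log t ^ 2 with hg
  have hderiv : ∀ t : ℝ, 1 < t → HasDerivAt f (g t) t := fun t ht ↦
    (Real.hasDerivAt_log (show t ≠ 0 by linarith)).inv (Real.log_pos ht).ne'
  have hmem : ∀ t ∈ Set.Icc 2 x, t ∈ ({0}ᶜ : Set ℝ) := fun t ht =>
    Set.mem_compl_singleton_iff.mpr (show (0 : ℝ) < t by linarith [ht.1]).ne'
  have hlogne : ∀ t ∈ Set.Icc 2 x, Real.log t ≠ 0 := fun t ht =>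
    (Real.log_pos (by linarith [ht.1])).ne'
  have hgcont : ContinuousOn g (Set.Icc 2 x) :=
    ContinuousOn.div (ContinuousOn.neg (continuousOn_inv₀.mono hmem))
      ((Real.continuousOn_log.mono hmem).pow 2) fun t ht => pow_ne_zero _ (hlogne t ht)
  have hf_diff : ∀ t ∈ Set.Icc 2 x, DifferentiableAt ℝ f t := fun t ht =>
    (hderiv t (by linarith [ht.1])).differentiableAt
  have hderiv_eq : Set.EqOn g (deriv f) (Set.Icc 2 x) := fun t ht =>
    ((hderiv t (by linarith [ht.1])).deriv).symm
  have hg_int : IntegrableOn g (Set.Icc 2 x) := hgcont.integrableOn_Icc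
  have hf_int : IntegrableOn (deriv f) (Set.Icc 2 x) :=
    hg_int.congr_fun hderiv_eq measurableSet_Icc
  have habel := sum_mul_eq_sub_sub_integral_mul c (by norm_num : (0 : ℝ) ≤ 2) hx hf_diff hf_int
  -- the partial sums are `S(t)`
  have hS : ∀ t : ℝ, ∑ k ∈ Icc 0 ⌊t⌋₊, c k = primeLogDivSum t := fun t ↦ by
    rw [hc, Literature.NumberTheory.LFunctions.MertensBound.sum_Icc_ite_prime_log_div]; rfl
  have hfl2 : ⌊(2 : ℝ)⌋₊ = 2 := by norm_num
  -- `f k c k = [k prime] / k`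
  have hfc : ∀ k : ℕ, f k * c k = if k.Prime then (k : ℝ)⁻¹ else 0 := by
    intro k
    simp only [hf, hc]
    split_ifs with hk
    · have hk1 : (1 : ℝ) < k := by exact_mod_cast hk.one_lt
      have : Real.log k ≠ 0 := (Real.log_pos hk1).ne'
      field_simp
    · simp
  have hsum : ∀ n : ℕ, ∑ k ∈ Ioc 0 n, f k * c k = ∑ p ∈ Nat.primesLE n, (p : ℝ)⁻¹ := by
    intro n
    rw [Nat.primesLE_eq_filter_Ioc_zero, Finset.sum_filter]
    exact Finset.sum_congr rfl fun k _ ↦ hfc k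
  have hx2 : 2 ≤ ⌊x⌋₊ := Nat.le_floor (by simpa using hx)
  have hlhs : ∑ k ∈ Ioc ⌊(2 : ℝ)⌋₊ ⌊x⌋₊, f k * c k = primeRecipSum x - 2⁻¹ := by
    rw [hfl2, primeRecipSum, ← hsum, eq_sub_iff_add_eq, add_comm,
      Finset.sum_Ioc_consecutive _ (Nat.zero_le 2) hx2 |>.symm]
    congr 1
    rw [show Finset.Ioc 0 2 = {1, 2} by decide, Finset.sum_pair (by norm_num), hfc, hfc]
    norm_num [Nat.prime_two, Nat.not_prime_one]
  -- boundary terms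
  have hb2 : f 2 * ∑ k ∈ Icc 0 ⌊(2 : ℝ)⌋₊, c k = 2⁻¹ := by
    rw [hS, primeLogDivSum, hfl2, primesLE_two, Finset.sum_singleton, hf]
    have : Real.log 2 ≠ 0 := (Real.log_pos (by norm_num)).ne'
    push_cast
    field_simp
  have hbx : f x * ∑ k ∈ Icc 0 ⌊x⌋₊, c k = primeLogDivSum x / Real.log x := by
    rw [hS, hf]
    ring
  -- the integral term
  have hint : ∫ t in Set.Ioc 2 x, deriv f t * ∑ k ∈ Icc 0 ⌊t⌋₊, c k =
      -∫ t in Ioc 2 x, primeLogDivSum t * (t⁻¹ / Real.log t ^ 2) := by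
    rw [← integral_neg]
    refine setIntegral_congr_fun measurableSet_Ioc fun t ht ↦ ?_
    rw [← hderiv_eq (Set.Ioc_subset_Icc_self ht), hS, hg]
    ring
  rw [hlhs, hb2, hbx, hint] at habel
  linarith

/-- Auxiliary (proof-internal): continuity of `t ↦ t⁻¹/log t` and `t ↦ t⁻¹/log² t` on `[2, x]`.
[folklore] -/
theorem continuousOn_inv_div_log_pow (x : ℝ) (n : ℕ) :
    ContinuousOn (fun t : ℝ ↦ t⁻¹ / Real.log t ^ n) (Set.Icc 2 x) := by
  have hmem : ∀ t ∈ Set.Icc 2 x, t ∈ ({0}ᶜ : Set ℝ) := fun t ht =>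
    Set.mem_compl_singleton_iff.mpr (show (0 : ℝ) < t by linarith [ht.1]).ne'
  have hlogne : ∀ t ∈ Set.Icc 2 x, Real.log t ≠ 0 := fun t ht =>
    (Real.log_pos (by linarith [ht.1])).ne'
  exact ContinuousOn.div (continuousOn_inv₀.mono hmem) ((Real.continuousOn_log.mono hmem).pow n)
    fun t ht => pow_ne_zero _ (hlogne t ht)

/-- Auxiliary (proof-internal). [folklore] -/
theorem continuousOn_inv_div_log (x : ℝ) :
    ContinuousOn (fun t : ℝ ↦ t⁻¹ / Real.log t) (Set.Icc 2 x) := by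
  simpa using continuousOn_inv_div_log_pow x 1

/-- `∫_2^x dt/(t log t) = log log x - log log 2` and the decomposition
`∫_2^x S(t)/(t log² t) dt = log log x - log log 2 + ∫_2^x τ(t)/(t log² t) dt` (HW (22.7.3), middle
line). [cite: HardyWright2008, §22.7 eq. (22.7.3)] -/
theorem integral_primeLogDivSum_mul {x : ℝ} (hx : 2 ≤ x) :
    ∫ t in Ioc 2 x, primeLogDivSum t * (t⁻¹ / Real.log t ^ 2) =
      Real.log (Real.log x) - Real.log (Real.log 2) +
        ∫ t in Ioc 2 x, mertensTau t * (t⁻¹ / Real.log t ^ 2) := by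
  have hw : IntegrableOn (fun t : ℝ ↦ t⁻¹ / Real.log t ^ 2) (Ioc 2 x) :=
    (continuousOn_inv_div_log_pow x 2).integrableOn_Icc.mono_set Set.Ioc_subset_Icc_self
  have h1 : IntegrableOn (fun t : ℝ ↦ t⁻¹ / Real.log t) (Ioc 2 x) :=
    (continuousOn_inv_div_log x).integrableOn_Icc.mono_set Set.Ioc_subset_Icc_self
  -- `τ w` is integrable: `τ` is bounded and measurable, `w` integrable
  have h2 : IntegrableOn (fun t ↦ mertensTau t * (t⁻¹ / Real.log t ^ 2)) (Ioc 2 x) := by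
    refine Integrable.mono' (hw.const_mul 4)
      ((measurable_mertensTau.mul ((measurable_inv).div
        (Real.measurable_log.pow_const 2))).aestronglyMeasurable) ?_
    rw [ae_restrict_iff' measurableSet_Ioc]
    refine Eventually.of_forall fun t ht ↦ ?_
    have ht0 : 0 < t := by linarith [ht.1]
    have hw0 : (0 : ℝ) ≤ t⁻¹ / Real.log t ^ 2 := by positivity
    have hτ := abs_mertensTau_le (x := t) (by linarith [ht.1])
    rw [norm_mul, Real.norm_eq_abs, Real.norm_eq_abs, abs_of_nonneg hw0]
    exact mul_le_mul_of_nonneg_right hτ hw0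
  have hsplit : ∀ t ∈ Ioc 2 x, primeLogDivSum t * (t⁻¹ / Real.log t ^ 2) =
      t⁻¹ / Real.log t + mertensTau t * (t⁻¹ / Real.log t ^ 2) := by
    intro t ht
    have hl : Real.log t ≠ 0 := (Real.log_pos (by linarith [ht.1])).ne'
    have e : Real.log t * (t⁻¹ / Real.log t ^ 2) = t⁻¹ / Real.log t := by
      rw [pow_two, ← mul_div_assoc, mul_div_mul_left _ _ hl]
    rw [show primeLogDivSum t = Real.log t + mertensTau t by rw [mertensTau]; ring, add_mul, e]
  rw [setIntegral_congr_fun measurableSet_Ioc hsplit, integral_add h1 h2]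
  congr 1
  -- FTC for `log log`
  have hderiv : ∀ t : ℝ, 1 < t →
      HasDerivAt (fun t ↦ Real.log (Real.log t)) (t⁻¹ / Real.log t) t := by
    intro t ht
    have ht0 : t ≠ 0 := (zero_lt_one.trans ht).ne'
    exact (Real.hasDerivAt_log ht0).log (Real.log_pos ht).ne'
  rw [← intervalIntegral.integral_of_le hx]
  refine intervalIntegral.integral_eq_sub_of_hasDerivAt (fun t ht => hderiv t ?_)
    ((continuousOn_inv_div_log x).mono ?_).intervalIntegrable
  · rw [Set.uIcc_of_le hx] at ht; linarith [ht.1]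
  · rw [Set.uIcc_of_le hx]

/-- `∫_2^∞ dt/(t log² t) < ∞` (`= 1/log 2`; the derivative of `-1/log t`). [folklore] -/
theorem integrableOn_inv_div_log_sq : IntegrableOn (fun t : ℝ ↦ t⁻¹ / Real.log t ^ 2) (Ioi 2) := by
  have hderiv : ∀ t ∈ Ioi (2 : ℝ),
      HasDerivAt (fun t ↦ -(Real.log t)⁻¹) (t⁻¹ / Real.log t ^ 2) t := by
    intro t ht
    have ht2 : (2 : ℝ) < t := ht
    have ht0 : t ≠ 0 := by linarith
    have hl : Real.log t ≠ 0 := (Real.log_pos (by linarith)).ne'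
    refine ((Real.hasDerivAt_log ht0).inv hl).neg.congr_deriv ?_
    ring
  have hcont : ContinuousWithinAt (fun t ↦ -(Real.log t)⁻¹) (Ici 2) 2 :=
    ((Real.continuousAt_log (by norm_num)).inv₀ (Real.log_pos (by norm_num)).ne').neg.continuousWithinAt
  have hlim : Tendsto (fun t ↦ -(Real.log t)⁻¹) atTop (𝓝 0) := by
    simpa using (tendsto_inv_atTop_zero.comp Real.tendsto_log_atTop).neg
  exact integrableOn_Ioi_deriv_of_nonneg hcont hderiv
    (fun t ht ↦ by have ht2 : (2 : ℝ) < t := ht; positivity) hlim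

/-- `∫_2^∞ τ(t)/(t log² t) dt` converges absolutely (`τ = O(1)`; HW (22.7.4)).
[cite: HardyWright2008, §22.7 eq. (22.7.4)] -/
theorem integrableOn_mertensTau_mul :
    IntegrableOn (fun t ↦ mertensTau t * (t⁻¹ / Real.log t ^ 2)) (Ioi 2) := by
  refine Integrable.mono' (integrableOn_inv_div_log_sq.const_mul 4)
    ((measurable_mertensTau.mul ((measurable_inv).div
      (Real.measurable_log.pow_const 2))).aestronglyMeasurable) ?_
  rw [ae_restrict_iff' measurableSet_Ioi]
  refine Eventually.of_forall fun t ht ↦ ?_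
  have ht2 : (2 : ℝ) < t := ht
  have ht0 : 0 < t := by linarith
  have hw0 : (0 : ℝ) ≤ t⁻¹ / Real.log t ^ 2 := by positivity
  have hτ := abs_mertensTau_le (x := t) (by linarith)
  rw [norm_mul, Real.norm_eq_abs, Real.norm_eq_abs, abs_of_nonneg hw0]
  exact mul_le_mul_of_nonneg_right hτ hw0

/-- **Mertens' second theorem, convergence** (Hardy–Wright Thm 427 with their formula for the
constant): `∑_{p ≤ x} 1/p - log log x → 1 - log log 2 + ∫_2^∞ τ(t) dt/(t log² t)` (`=: B₁`).
[cite: HardyWright2008, Thm 427 (§22.7)] -/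
theorem tendsto_primeRecipSum_sub_loglog_integral :
    Tendsto (fun x ↦ primeRecipSum x - Real.log (Real.log x)) atTop
      (𝓝 (1 - Real.log (Real.log 2) + ∫ t in Ioi 2, mertensTau t * (t⁻¹ / Real.log t ^ 2))) := by
  have hev : (fun x ↦ 1 + mertensTau x / Real.log x - Real.log (Real.log 2) +
      ∫ t in Ioc 2 x, mertensTau t * (t⁻¹ / Real.log t ^ 2)) =ᶠ[atTop]
      fun x ↦ primeRecipSum x - Real.log (Real.log x) := by
    filter_upwards [eventually_ge_atTop 2] with x hx
    rw [primeRecipSum_eq_add_integral hx, integral_primeLogDivSum_mul hx,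
      show primeLogDivSum x = Real.log x + mertensTau x by rw [mertensTau]; ring]
    have hl : Real.log x ≠ 0 := (Real.log_pos (by linarith)).ne'
    field_simp
    ring
  refine Tendsto.congr' hev ?_
  have h1 : Tendsto (fun x ↦ mertensTau x / Real.log x) atTop (𝓝 0) := by
    have h0 : Tendsto (fun x ↦ 4 * (Real.log x)⁻¹) atTop (𝓝 0) := by
      simpa using (tendsto_inv_atTop_zero.comp Real.tendsto_log_atTop).const_mul 4
    refine squeeze_zero_norm' ?_ h0
    filter_upwards [eventually_gt_atTop 1] with x hx
    have hl : 0 < Real.log x := Real.log_pos hx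
    rw [Real.norm_eq_abs, abs_div, abs_of_pos hl, div_eq_mul_inv]
    exact mul_le_mul_of_nonneg_right (abs_mertensTau_le hx.le) (inv_nonneg.2 hl.le)
  have h2 : Tendsto (fun x ↦ ∫ t in Ioc 2 x, mertensTau t * (t⁻¹ / Real.log t ^ 2)) atTop
      (𝓝 (∫ t in Ioi 2, mertensTau t * (t⁻¹ / Real.log t ^ 2))) := by
    have := intervalIntegral_tendsto_integral_Ioi 2 integrableOn_mertensTau_mul tendsto_id
    refine this.congr' ?_
    filter_upwards [eventually_ge_atTop 2] with x hx
    exact intervalIntegral.integral_of_le hx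
  have := ((h1.const_add 1).sub_const (Real.log (Real.log 2))).add h2
  simpa using this

/-! ### The absolutely convergent part `∑_p (a_p - 1/p)` -/

/-- The terms `-log(1 - 1/p) - 1/p ∈ (0, 1/(2p(p-1)))` at primes, `0` elsewhere (HW (22.7.1)).
[cite: HardyWright2008, §22.7 eq. (22.7.1)] -/
def primeLogCoeffSubInv (k : ℕ) : ℝ :=
  if k.Prime then -Real.log (1 - (k : ℝ)⁻¹) - (k : ℝ)⁻¹ else 0

/-- `∑_p (-log(1 - 1/p) - 1/p)` converges (absolutely, terms `≤ 2/p²`). [cite: HardyWright2008, §22.7 eq. (22.7.1)] -/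
theorem summable_primeLogCoeffSubInv : Summable primeLogCoeffSubInv := by
  refine Summable.of_norm_bounded ((summable_nat_pow_inv.2 one_lt_two).mul_left 2) fun k ↦ ?_
  rw [Real.norm_eq_abs]
  by_cases hk : k.Prime
  · have h := Literature.NumberTheory.LFunctions.Nicolas.abs_primeLogCoeff_sub_inv_le hk
    rw [Literature.NumberTheory.LFunctions.Nicolas.primeLogCoeff_of_prime hk] at h
    simp only [primeLogCoeffSubInv, if_pos hk]
    rw [div_eq_mul_inv] at h
    exact h
  · simp only [primeLogCoeffSubInv, if_neg hk, abs_zero]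
    positivity

/-- `A(x) - P(x) = ∑_{p ≤ x} (-log(1 - 1/p) - 1/p)`. [folklore] -/
theorem mertensLog_sub_primeRecipSum (x : ℝ) :
    Literature.NumberTheory.LFunctions.Nicolas.mertensLog x - primeRecipSum x =
      ∑ k ∈ Finset.range (⌊x⌋₊ + 1), primeLogCoeffSubInv k := by
  rw [Literature.NumberTheory.LFunctions.Nicolas.mertensLog_eq_natCast_floor, Literature.NumberTheory.LFunctions.Nicolas.mertensLog_natCast, primeRecipSum,
    ← Finset.sum_sub_distrib, Nat.primesLE_eq_filter_range, Finset.sum_filter]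
  refine Finset.sum_congr rfl fun k _ ↦ ?_
  by_cases hk : k.Prime <;> simp [primeLogCoeffSubInv, hk]

/-- `A(x) - P(x) → ∑_p (-log(1 - 1/p) - 1/p)`. [cite: HardyWright2008, §22.8, proof of Thm 429] -/
theorem tendsto_mertensLog_sub_primeRecipSum :
    Tendsto (fun x ↦ Literature.NumberTheory.LFunctions.Nicolas.mertensLog x - primeRecipSum x) atTop
      (𝓝 (∑' k, primeLogCoeffSubInv k)) := by
  have h : (fun x ↦ Literature.NumberTheory.LFunctions.Nicolas.mertensLog x - primeRecipSum x) =
      (fun n ↦ ∑ k ∈ Finset.range n, primeLogCoeffSubInv k) ∘ fun x : ℝ ↦ ⌊x⌋₊ + 1 := by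
    funext x
    exact mertensLog_sub_primeRecipSum x
  rw [h]
  exact summable_primeLogCoeffSubInv.hasSum.tendsto_sum_nat.comp
    ((tendsto_add_atTop_nat 1).comp tendsto_nat_floor_atTop)


/-! ### Identification of the constant through `ζ(1+σ)` (Hardy–Wright Thm 428) -/

/-- For real `σ > 0`: `σ ∫_1^∞ A(x) x^{-σ-1} dx = ∑_p a_p p^{-σ}` (real part of the tree's
`Literature.NumberTheory.LFunctions.Nicolas.primeLogLSeries_eq_mul_integral`, MV Thm. 1.3). [cite: MontgomeryVaughan2007, §1.2, Thm. 1.3] -/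
theorem mul_integral_mertensLog_rpow {σ : ℝ} (hσ : 0 < σ) :
    σ * ∫ x in Ioi (1 : ℝ), Literature.NumberTheory.LFunctions.Nicolas.mertensLog x * x ^ (-(σ + 1)) =
      (Literature.NumberTheory.LFunctions.Nicolas.primeLogLSeries σ).re := by
  have h := Literature.NumberTheory.LFunctions.Nicolas.primeLogLSeries_eq_mul_integral (s := σ) (by simpa using hσ)
  have h2 : ∫ t in Ioi (1 : ℝ), (Literature.NumberTheory.LFunctions.Nicolas.mertensLog t : ℂ) * (t : ℂ) ^ (-((σ : ℂ) + 1)) =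
      ((∫ x in Ioi (1 : ℝ), Literature.NumberTheory.LFunctions.Nicolas.mertensLog x * x ^ (-(σ + 1)) : ℝ) : ℂ) := by
    have h3 := Literature.NumberTheory.LFunctions.Landau.mellinIoiLog_ofReal (g := Literature.NumberTheory.LFunctions.Nicolas.mertensLog) 0 σ
    rw [Literature.NumberTheory.LFunctions.Landau.mellinIoiLog_zero] at h3
    simpa [Literature.NumberTheory.LFunctions.Landau.mellinIoi] using h3
  rw [h, h2, ← Complex.ofReal_mul, Complex.ofReal_re]

/-- For real `σ > 0`, `ζ(1+σ)` is real and positive and `∑_p -log(1 - p^{-1-σ}) = log ζ(1+σ)`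
(logarithm of the Euler product, Mathlib `riemannZeta_eulerProduct_exp_log` via the tree's
`Literature.NumberTheory.LFunctions.Nicolas.exp_primeZetaLog`). [cite: HardyWright2008, Thm 280; §22.8] -/
theorem primeZetaLog_re_eq_log {σ : ℝ} (hσ : 0 < σ) :
    (Literature.NumberTheory.LFunctions.Nicolas.primeZetaLog (1 + σ)).re = Real.log (riemannZeta (1 + σ)).re ∧
      (riemannZeta (1 + σ)).re = Real.exp (Literature.NumberTheory.LFunctions.Nicolas.primeZetaLog (1 + σ)).re := by
  set z : ℂ := Literature.NumberTheory.LFunctions.Nicolas.primeZetaLog (1 + σ) with hz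
  have him : z.im = 0 := by
    have := Literature.NumberTheory.LFunctions.Nicolas.primeZetaLog_ofReal_im (x := 1 + σ) (by linarith)
    rw [hz, show (1 : ℂ) + σ = ((1 + σ : ℝ) : ℂ) by push_cast; ring]
    exact this
  have hzre : z = (z.re : ℂ) := Complex.ext (by simp) (by simp [him])
  have hexp : Complex.exp z = riemannZeta (1 + σ) :=
    Literature.NumberTheory.LFunctions.Nicolas.exp_primeZetaLog (w := 1 + σ) (by simp; linarith)
  have hζ : riemannZeta (1 + σ) = ((Real.exp z.re : ℝ) : ℂ) := by
    rw [← hexp, hzre, ← Complex.ofReal_exp, Complex.ofReal_re]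
  have hre : (riemannZeta (1 + σ)).re = Real.exp z.re := by rw [hζ, Complex.ofReal_re]
  exact ⟨by rw [hre, Real.log_exp], hre⟩

/-- **The key identity** (Hardy–Wright §22.8, the displayed formula for
`g(δ) + log δ - B₁ + γ` rearranged, with `A` in place of `∑ 1/p`): for real `σ > 0`,
`σ ∫_1^∞ (A(x) - log log x) x^{-σ-1} dx = γ + Re primeLogDiff(σ) + log Re(σ ζ(1+σ))`, from
`∑_p a_p p^{-σ} = primeLogDiff(σ) + log ζ(1+σ)` and `σ ∫_1^∞ log log x · x^{-σ-1} dx = -γ - log σ`.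
[cite: HardyWright2008, §22.8, proof of Thm 428] -/
theorem mul_integral_mertensLog_sub_loglog {σ : ℝ} (hσ : 0 < σ) :
    σ * ∫ x in Ioi (1 : ℝ), (Literature.NumberTheory.LFunctions.Nicolas.mertensLog x - Real.log (Real.log x)) * x ^ (-(σ + 1)) =
      Real.eulerMascheroniConstant + (Literature.NumberTheory.LFunctions.Nicolas.primeLogDiff σ).re +
        Real.log ((σ : ℂ) * riemannZeta (1 + σ)).re := by
  have hA : IntegrableOn (fun x ↦ Literature.NumberTheory.LFunctions.Nicolas.mertensLog x * x ^ (-(σ + 1))) (Ioi 1) :=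
    Literature.NumberTheory.LFunctions.Nicolas.integrableOn_rpow_of_le_log Literature.NumberTheory.LFunctions.Nicolas.measurable_mertensLog (C := 2)
      (fun x hx ↦ by
        have := Literature.NumberTheory.LFunctions.Nicolas.abs_mertensLog_le x
        rwa [abs_of_nonneg (Real.log_nonneg hx.le)] at this) hσ
  have hL : IntegrableOn (fun x ↦ Real.log (Real.log x) * x ^ (-(σ + 1))) (Ioi 1) :=
    Literature.NumberTheory.LFunctions.Nicolas.integrableOn_loglog_rpow hσ
  have hsplit : ∫ x in Ioi (1 : ℝ), (Literature.NumberTheory.LFunctions.Nicolas.mertensLog x - Real.log (Real.log x)) * x ^ (-(σ + 1)) =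
      (∫ x in Ioi (1 : ℝ), Literature.NumberTheory.LFunctions.Nicolas.mertensLog x * x ^ (-(σ + 1))) -
        ∫ x in Ioi (1 : ℝ), Real.log (Real.log x) * x ^ (-(σ + 1)) := by
    rw [← integral_sub hA hL]
    refine setIntegral_congr_fun measurableSet_Ioi fun x _ ↦ ?_
    ring
  rw [hsplit, mul_sub, mul_integral_mertensLog_rpow hσ, Literature.NumberTheory.LFunctions.Nicolas.integral_loglog_rpow hσ]
  -- `primeLogLSeries σ = primeLogDiff σ + primeZetaLog (1 + σ)`
  have hdiff := Literature.NumberTheory.LFunctions.Nicolas.primeLogDiff_eq (s := σ) (by simpa using hσ)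
  have hP : (Literature.NumberTheory.LFunctions.Nicolas.primeLogLSeries σ).re =
      (Literature.NumberTheory.LFunctions.Nicolas.primeLogDiff σ).re + (Literature.NumberTheory.LFunctions.Nicolas.primeZetaLog (1 + σ)).re := by
    rw [hdiff, Complex.sub_re]
    ring
  obtain ⟨hlog, hre⟩ := primeZetaLog_re_eq_log hσ
  have hζpos : 0 < (riemannZeta (1 + σ)).re := by rw [hre]; exact Real.exp_pos _
  have hmul : ((σ : ℂ) * riemannZeta (1 + σ)).re = σ * (riemannZeta (1 + σ)).re := by
    simp [Complex.mul_re]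
  rw [hP, hlog, hmul, Real.log_mul hσ.ne' hζpos.ne']
  field_simp
  ring

/-- `primeLogDiff` is continuous at `0` with value `0`: `Re primeLogDiff(σ) → 0` as `σ → 0+`
(the tree's `Literature.NumberTheory.LFunctions.Nicolas.differentiableOn_primeLogDiff`, `primeLogDiff_zero`; Hardy–Wright:
"`F(δ) → F(0)` as `δ → 0`"). [cite: HardyWright2008, §22.8, proof of Thm 428] -/
theorem tendsto_primeLogDiff_re :
    Tendsto (fun σ : ℝ ↦ (Literature.NumberTheory.LFunctions.Nicolas.primeLogDiff σ).re) (𝓝[>] 0) (𝓝 0) := by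
  have hc : ContinuousAt Literature.NumberTheory.LFunctions.Nicolas.primeLogDiff 0 :=
    Literature.NumberTheory.LFunctions.Nicolas.differentiableOn_primeLogDiff.continuousOn.continuousAt
      ((Literature.NumberTheory.LFunctions.Nicolas.isOpen_re_gt' (-1 / 2)).mem_nhds (by simp; norm_num))
  have h1 : Tendsto (fun σ : ℝ ↦ (σ : ℂ)) (𝓝 0) (𝓝 (0 : ℂ)) := by
    simpa using Complex.continuous_ofReal.tendsto 0
  have h2 := (Complex.continuous_re.tendsto _).comp (hc.tendsto.comp h1)
  rw [Literature.NumberTheory.LFunctions.Nicolas.primeLogDiff_zero, Complex.zero_re] at h2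
  exact tendsto_nhdsWithin_of_tendsto_nhds h2

/-- `log Re(σ ζ(1+σ)) → 0` as `σ → 0+` (the simple pole of `ζ` at `1` with residue `1`, Mathlib
`riemannZeta_residue_one`; Hardy–Wright: "`log ζ(1+δ) + log δ → 0`").
[cite: HardyWright2008, §22.8, proof of Thm 428] -/
theorem tendsto_log_re_mul_zeta :
    Tendsto (fun σ : ℝ ↦ Real.log ((σ : ℂ) * riemannZeta (1 + σ)).re) (𝓝[>] 0) (𝓝 0) := by
  have h1 : Tendsto (fun σ : ℝ ↦ (1 : ℂ) + σ) (𝓝[>] 0) (𝓝[≠] 1) := by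
    refine tendsto_nhdsWithin_iff.2 ⟨?_, ?_⟩
    · have : Tendsto (fun σ : ℝ ↦ (1 : ℂ) + σ) (𝓝 0) (𝓝 ((1 : ℂ) + (0 : ℝ))) :=
        ((continuous_const.add Complex.continuous_ofReal).tendsto 0)
      simp only [Complex.ofReal_zero, add_zero] at this
      exact tendsto_nhdsWithin_of_tendsto_nhds this
    · filter_upwards [self_mem_nhdsWithin] with σ (hσ : 0 < σ)
      rw [Set.mem_compl_singleton_iff]
      intro h
      have := congrArg Complex.re h
      simp at this
      exact hσ.ne' this
  have h2 := riemannZeta_residue_one.comp h1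
  have h3 : Tendsto (fun σ : ℝ ↦ (σ : ℂ) * riemannZeta (1 + σ)) (𝓝[>] 0) (𝓝 1) := by
    refine h2.congr fun σ ↦ ?_
    simp only [Function.comp_apply, add_sub_cancel_left]
  have h4 := (Complex.continuous_re.tendsto _).comp h3
  have h5 := ((Real.continuousAt_log one_ne_zero).tendsto).comp h4
  simpa [Function.comp_def] using h5

/-- **`σ ∫_1^∞ (A(x) - log log x) x^{-σ-1} dx → γ` as `σ → 0+`.**
[cite: HardyWright2008, §22.8, proof of Thm 428] -/
theorem tendsto_mul_integral_mertensLog_sub_loglog :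
    Tendsto (fun σ : ℝ ↦ σ * ∫ x in Ioi (1 : ℝ),
      (Literature.NumberTheory.LFunctions.Nicolas.mertensLog x - Real.log (Real.log x)) * x ^ (-(σ + 1))) (𝓝[>] 0)
      (𝓝 Real.eulerMascheroniConstant) := by
  have hev : (fun σ : ℝ ↦ Real.eulerMascheroniConstant + (Literature.NumberTheory.LFunctions.Nicolas.primeLogDiff σ).re +
      Real.log ((σ : ℂ) * riemannZeta (1 + σ)).re) =ᶠ[𝓝[>] 0]
      fun σ : ℝ ↦ σ * ∫ x in Ioi (1 : ℝ),
        (Literature.NumberTheory.LFunctions.Nicolas.mertensLog x - Real.log (Real.log x)) * x ^ (-(σ + 1)) := by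
    filter_upwards [self_mem_nhdsWithin] with σ (hσ : 0 < σ)
    exact (mul_integral_mertensLog_sub_loglog hσ).symm
  refine Tendsto.congr' hev ?_
  have := (tendsto_primeLogDiff_re.const_add Real.eulerMascheroniConstant).add tendsto_log_re_mul_zeta
  simpa using this

/-! ### Mertens' theorems with their constants -/

/-- **`A(x) - log log x → γ`**: `∑_{p ≤ x} -log(1 - 1/p) = log log x + γ + o(1)`, the logarithmic
form of Mertens' theorem (Hardy–Wright Thm 429). Proof: the limit exists by Thm 427 and the
convergence of `∑_p (a_p - 1/p)`; its Abel mean `σ ∫_1^∞ (A - log log) x^{-σ-1} dx` tends to `γ`;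
limits are unique. [cite: HardyWright2008, Thm 429 (§22.8)] -/
theorem tendsto_mertensLog_sub_loglog :
    Tendsto (fun x ↦ Literature.NumberTheory.LFunctions.Nicolas.mertensLog x - Real.log (Real.log x)) atTop
      (𝓝 Real.eulerMascheroniConstant) := by
  set B : ℝ := 1 - Real.log (Real.log 2) + ∫ t in Ioi 2, mertensTau t * (t⁻¹ / Real.log t ^ 2)
  set D : ℝ := ∑' k, primeLogCoeffSubInv k
  have hlim : Tendsto (fun x ↦ Literature.NumberTheory.LFunctions.Nicolas.mertensLog x - Real.log (Real.log x)) atTop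
      (𝓝 (D + B)) := by
    have := tendsto_mertensLog_sub_primeRecipSum.add tendsto_primeRecipSum_sub_loglog_integral
    exact this.congr fun x ↦ by ring
  have hint : ∀ σ : ℝ, 0 < σ → IntegrableOn
      (fun x ↦ (Literature.NumberTheory.LFunctions.Nicolas.mertensLog x - Real.log (Real.log x)) * x ^ (-(σ + 1))) (Ioi 1) :=
    fun σ hσ ↦ Literature.NumberTheory.LFunctions.Nicolas.integrableOn_sub_rpow
      (Literature.NumberTheory.LFunctions.Nicolas.integrableOn_rpow_of_le_log Literature.NumberTheory.LFunctions.Nicolas.measurable_mertensLog (C := 2)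
        (fun x hx ↦ by
          have := Literature.NumberTheory.LFunctions.Nicolas.abs_mertensLog_le x
          rwa [abs_of_nonneg (Real.log_nonneg hx.le)] at this) hσ)
      (Literature.NumberTheory.LFunctions.Nicolas.integrableOn_loglog_rpow hσ)
  have h1 := tendsto_mul_integral_rpow_of_tendsto hint hlim
  have heq : D + B = Real.eulerMascheroniConstant :=
    tendsto_nhds_unique h1 tendsto_mul_integral_mertensLog_sub_loglog
  rwa [heq] at hlim

/-- **Mertens' theorem** (Mertens 1874; Hardy–Wright Thm 429):
`∏_{p ≤ x} (1 - 1/p) ~ e^{-γ}/log x`, i.e. `log x · ∏_{p ≤ x} (1 - 1/p) → e^{-γ}`.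
[cite: HardyWright2008, Thm 429 (§22.8)] -/
theorem tendsto_log_mul_prod_one_sub_inv :
    Tendsto (fun x : ℝ ↦ Real.log x * ∏ p ∈ Nat.primesLE ⌊x⌋₊, (1 - (p : ℝ)⁻¹)) atTop
      (𝓝 (Real.exp (-Real.eulerMascheroniConstant))) := by
  have h := (Real.continuous_exp.tendsto _).comp tendsto_mertensLog_sub_loglog.neg
  refine h.congr' ?_
  filter_upwards [eventually_gt_atTop 1] with x hx
  rw [Function.comp_apply, neg_sub, Real.exp_sub, Real.exp_log (Real.log_pos hx),
    Literature.NumberTheory.LFunctions.Nicolas.mertensLog_eq_natCast_floor, Literature.NumberTheory.LFunctions.Nicolas.exp_mertensLog_natCast,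
    Finset.prod_inv_distrib, div_eq_mul_inv, inv_inv]

/-- Mertens' theorem, reciprocal form: `(∏_{p ≤ x} (1 - 1/p))⁻¹ / log x → e^γ`.
[cite: HardyWright2008, Thm 429 (§22.8)] -/
theorem tendsto_prod_one_sub_inv_inv_div_log :
    Tendsto (fun x : ℝ ↦ (∏ p ∈ Nat.primesLE ⌊x⌋₊, (1 - (p : ℝ)⁻¹)⁻¹) / Real.log x) atTop
      (𝓝 (Real.exp Real.eulerMascheroniConstant)) := by
  have h := (Real.continuous_exp.tendsto _).comp tendsto_mertensLog_sub_loglog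
  refine h.congr' ?_
  filter_upwards [eventually_gt_atTop 1] with x hx
  rw [Function.comp_apply, Real.exp_sub, Real.exp_log (Real.log_pos hx),
    Literature.NumberTheory.LFunctions.Nicolas.mertensLog_eq_natCast_floor, Literature.NumberTheory.LFunctions.Nicolas.exp_mertensLog_natCast]

/-- Mertens' theorem along the integers: `log n · ∏_{p ≤ n} (1 - 1/p) → e^{-γ}`.
[cite: HardyWright2008, Thm 429 (§22.8)] -/
theorem tendsto_log_mul_prod_one_sub_inv_nat :
    Tendsto (fun n : ℕ ↦ Real.log n * ∏ p ∈ Nat.primesLE n, (1 - (p : ℝ)⁻¹)) atTop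
      (𝓝 (Real.exp (-Real.eulerMascheroniConstant))) := by
  have h := tendsto_log_mul_prod_one_sub_inv.comp tendsto_natCast_atTop_atTop
  refine h.congr fun n ↦ ?_
  simp only [Function.comp_apply, Nat.floor_natCast]

/-- **The Meissel–Mertens constant** `B₁ = γ + ∑_p (log(1 - 1/p) + 1/p)` (Hardy–Wright (22.8.1)).
[cite: HardyWright2008, Thm 428 (§22.8) eq. (22.8.1)] -/
def meisselMertens : ℝ :=
  Real.eulerMascheroniConstant + ∑' p : Nat.Primes, (Real.log (1 - (p : ℝ)⁻¹) + (p : ℝ)⁻¹)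

/-- Auxiliary (proof-internal): `∑_k d_k = -∑_p (log(1 - 1/p) + 1/p)`. [folklore] -/
theorem tsum_primeLogCoeffSubInv :
    ∑' k, primeLogCoeffSubInv k = -∑' p : Nat.Primes, (Real.log (1 - (p : ℝ)⁻¹) + (p : ℝ)⁻¹) := by
  rw [← tsum_neg]
  have h := Function.Injective.tsum_eq (g := fun p : Nat.Primes ↦ (p : ℕ)) (f := primeLogCoeffSubInv)
    (fun p q h ↦ Subtype.ext h) (fun n hn ↦ by
      rw [Function.mem_support] at hn
      have hp : n.Prime := by
        by_contra h
        exact hn (by simp [primeLogCoeffSubInv, h])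
      exact ⟨⟨n, hp⟩, rfl⟩)
  rw [← h]
  refine tsum_congr fun p ↦ ?_
  rw [primeLogCoeffSubInv, if_pos p.2]
  ring

/-- **Mertens' second theorem with its constant** (Hardy–Wright Thms 427–428):
`∑_{p ≤ x} 1/p - log log x → B₁ = γ + ∑_p (log(1 - 1/p) + 1/p)`.
[cite: HardyWright2008, Thm 428 (§22.8)] -/
theorem tendsto_primeRecipSum_sub_loglog :
    Tendsto (fun x ↦ primeRecipSum x - Real.log (Real.log x)) atTop (𝓝 meisselMertens) := by
  have := tendsto_mertensLog_sub_loglog.sub tendsto_mertensLog_sub_primeRecipSum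
  rw [tsum_primeLogCoeffSubInv, sub_neg_eq_add] at this
  exact this.congr fun x ↦ by ring

/-- The same with the sum written out: `∑_{p ≤ x} 1/p - log log x → γ + ∑_p (log(1 - 1/p) + 1/p)`.
[cite: HardyWright2008, Thm 428 (§22.8)] -/
theorem tendsto_sum_primesLE_inv_sub_loglog :
    Tendsto (fun x : ℝ ↦ ∑ p ∈ Nat.primesLE ⌊x⌋₊, (p : ℝ)⁻¹ - Real.log (Real.log x)) atTop
      (𝓝 (Real.eulerMascheroniConstant +
        ∑' p : Nat.Primes, (Real.log (1 - (p : ℝ)⁻¹) + (p : ℝ)⁻¹))) :=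
  tendsto_primeRecipSum_sub_loglog

/-- Hardy–Wright's integral formula for the constant: `B₁ = 1 - log log 2 + ∫_2^∞ τ(t) dt/(t log² t)`
((22.7.3)), identified with `γ + ∑_p (log(1 - 1/p) + 1/p)` (Thm 428).
[cite: HardyWright2008, §22.7 eq. (22.7.3); Thm 428] -/
theorem meisselMertens_eq_integral :
    meisselMertens = 1 - Real.log (Real.log 2) + ∫ t in Ioi 2, mertensTau t * (t⁻¹ / Real.log t ^ 2) :=
  tendsto_nhds_unique tendsto_primeRecipSum_sub_loglog tendsto_primeRecipSum_sub_loglog_integral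

end Literature.NumberTheory.LFunctions.Mertens
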